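import Literature.Topology.FourManifolds.SlideContext
import Literature.Topology.FourManifolds.SublevelOneHandlebody
import Literature.AlgebraicTopology.FundamentalGroup.VanKampenKernel
import Literature.AlgebraicTopology.FundamentalGroup.IsotopyTrack
import HarnessLib

/-!
# Loops below the seed level come from loops of the seed level

Topic `Literature/Topology/FourManifolds` (fact seat
`provefact-Literature.Topology.FourManifolds.lauden-f709dd520c`, Laudenbach–Poénaru's Lemma 2: the
slide `H₃` pushes one foot of a `1`-handle "once around" a loop *of the level* below it; here we
produce, for every loop of the sublevel set, such a loop of the level).  Everything here is
**proved**; no named facts.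

Let `C` be a slide context (`SlideContext.lean`) whose function has exactly one critical point
of index `0` and none of index `≥ 2`, the one of index `0` below the seed level `c` — as for
the Morse functions of a `1`-handlebody with one `0`-handle.  Then the sublevel set
`{f ≤ c}` is again such a `1`-handlebody and `π₁` of its boundary, the seed level, maps
**onto** its `π₁` (`IsMorseAdapted.surjective_inclHom_boundary_sublevel`,
`SublevelOneHandlebody.lean`, `dim = n + 1 ≥ 3`).  Consequently
(`SlideContext.exists_levelLoop`): for a point `v` of the seed level, a path `A : x₀ ⟶ v` and
a loop `γ` at `x₀`, both inside `{f ≤ c}`, there is a loop `β` of the seed level manifold at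
`v` with `[A · β · A⁻¹] = [γ]` in `M`.

## References

* F. Laudenbach, V. Poénaru, Bull. Soc. Math. France 100 (1972), proof of Lemma 2 (p. 340).
  [LaudenbachPoenaruBSMF1972]
* J. Milnor, *Lectures on the h-cobordism theorem* (1965), Lemma 2.9, Thm. 3.14 and Remark.
  [MilnorHCobordism1965]
* A. Hatcher, *Algebraic Topology* (2002), Prop. 1.26. [HatcherAT2002]
-/

open scoped Manifold ContDiff Topology unitInterval
open Set Function Metric

noncomputable section

namespace Literature.Topology.FourManifolds

open Literature.AlgebraicTopology.FundamentalGroup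

universe u

namespace SlideContext

variable {n : ℕ} {M : Type u} [TopologicalSpace M] [T2Space M] [SecondCountableTopology M] [CompactSpace M]
  [ChartedSpace (EuclideanHalfSpace (n + 1)) M] [IsManifold (𝓡∂ (n + 1)) ∞ M] (C : SlideContext n M)

omit [T2Space M] [SecondCountableTopology M] [CompactSpace M] in
/-- The seed level is not a critical value. [folklore] -/
theorem apply_ne_seedLevel_of_isMCriticalPt {z : M} (hz : IsMCriticalPt (𝓡∂ (n + 1)) C.S.f z) :
    C.S.f z ≠ C.toCtx.c + C.toCtx.σ := by
  show C.S.f z ≠ C.c + 0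
  rw [add_zero]
  intro h
  by_cases hzp : z = C.S.p
  · have := C.hcτ; rw [hzp] at h; nlinarith [C.τ_pos, sq_nonneg C.S.ε]
  · exact C.hreg z (by rw [h]; linarith [C.τ_pos]) hzp hz

/-- **Loops of the sublevel set `{f ≤ c}` at a point of the seed level come from loops of the
seed level** (`π₁(∂) → π₁` onto for the `1`-handlebody `{f ≤ c}`), for a slide context whose
function has one critical point of index `0`, below `c`, and none of index `≥ 2`.
[cite: MilnorHCobordism1965, Lemma 2.9, Thm. 3.14 and Remark] [cite: HatcherAT2002, Prop. 1.26] -/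
theorem exists_levelLoop_of_loop (h0 : (criticalSetOfIndex (𝓡∂ (n + 1)) C.S.f 0).ncard = 1)
    (h2 : ∀ k, 2 ≤ k → (criticalSetOfIndex (𝓡∂ (n + 1)) C.S.f k).ncard = 0)
    (hmin : ∀ z ∈ criticalSetOfIndex (𝓡∂ (n + 1)) C.S.f 0, C.S.f z < C.c)
    (v : C.toCtx.Sl'.Level (C.toCtx.c + C.toCtx.σ))
    (δ : Path (C.toCtx.Sl'.levelIncl v) (C.toCtx.Sl'.levelIncl v)) (hδ : ∀ s, C.S.f (δ s) ≤ C.c) :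
    ∃ β : Path v v,
      Path.Homotopic.Quotient.mk (β.map ((continuous_subtype_val.comp continuous_subtype_val) :
        Continuous (C.toCtx.Sl'.levelIncl : C.toCtx.Sl'.Level (C.toCtx.c + C.toCtx.σ) → M))) =
      Path.Homotopic.Quotient.mk δ := by
  have hc1 : C.toCtx.c + C.toCtx.σ < 1 := by
    show C.c + 0 < 1; have := C.hcτ; have := C.htop; nlinarith [C.τ_pos, sq_nonneg C.S.ε]
  have hsurj := C.hF.surjective_inclHom_boundary_sublevel C.hn hc1
    (fun z hz => C.apply_ne_seedLevel_of_isMCriticalPt hz) h0 h2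
    (fun z hz => by show C.S.f z < C.c + 0; rw [add_zero]; exact hmin z hz)
    (C.toCtx.hint' C.toCtx.c'_mem.2.le) (C.toCtx.hreg_level' C.toCtx.c'_mem) v.1 v.2
  -- the loop, lifted to the sublevel set
  have hδ' : ∀ s, δ s ∈ C.toCtx.Sl'.f ⁻¹' Iic (C.toCtx.c + C.toCtx.σ) := fun s => by
    show C.S.f (δ s) ≤ C.c + 0; rw [add_zero]; exact hδ s
  set δ' := VanKampen.liftPath (C.toCtx.Sl'.f ⁻¹' Iic (C.toCtx.c + C.toCtx.σ)) δ hδ' with hδ'def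
  obtain ⟨b, hb⟩ := hsurj (FundamentalGroup.fromPath (Path.Homotopic.Quotient.mk δ'))
  set β : Path v v := (FundamentalGroup.toPath b).out with hβ
  have hbβ : FundamentalGroup.fromPath (Path.Homotopic.Quotient.mk β) = b := by
    rw [hβ]; exact Quotient.out_eq _
  refine ⟨β, ?_⟩
  rw [← hbβ] at hb
  have key : VanKampen.inclHom _ v.1 v.2 (FundamentalGroup.fromPath (Path.Homotopic.Quotient.mk β)) =
      FundamentalGroup.fromPath (Path.Homotopic.Quotient.mk (β.map continuous_subtype_val)) :=
    VanKampen.inclHom_fromPath v.2 β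
  -- `⟦β.map val⟧ = ⟦δ'⟧` in the sublevel set; map it to `M`
  have hb' : Path.Homotopic.Quotient.mk (β.map continuous_subtype_val) = Path.Homotopic.Quotient.mk δ' := key.symm.trans hb
  have h := congrArg (fun q => Path.Homotopic.Quotient.map q (⟨Subtype.val, continuous_subtype_val⟩ :
    C(↥(C.toCtx.Sl'.f ⁻¹' Iic (C.toCtx.c + C.toCtx.σ)), M))) hb'
  simp only [← Path.Homotopic.Quotient.mk_map] at h
  have e1 : (β.map continuous_subtype_val).map (map_continuous (⟨Subtype.val, continuous_subtype_val⟩ :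
      C(↥(C.toCtx.Sl'.f ⁻¹' Iic (C.toCtx.c + C.toCtx.σ)), M))) =
      β.map ((continuous_subtype_val.comp continuous_subtype_val) :
        Continuous (C.toCtx.Sl'.levelIncl : C.toCtx.Sl'.Level (C.toCtx.c + C.toCtx.σ) → M)) := by
    ext s; rfl
  have e2 : δ'.map (map_continuous (⟨Subtype.val, continuous_subtype_val⟩ :
      C(↥(C.toCtx.Sl'.f ⁻¹' Iic (C.toCtx.c + C.toCtx.σ)), M))) = δ := by
    ext s; rfl
  rw [e1, e2] at h
  exact h

/-- **A loop below the seed level is conjugate to a loop of the seed level.**  For a point `v`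
of the seed level, a path `A : x₀ ⟶ v` and a loop `γ` at `x₀` inside `{f ≤ c}`, there is a loop
`β` of the seed level manifold at `v` with `[A · β · A⁻¹] = [γ]`.
[cite: LaudenbachPoenaruBSMF1972, §2, proof of Lemma 2 (p. 340)] [cite: MilnorHCobordism1965, Thm. 3.14 and Remark] -/
theorem exists_levelLoop (h0 : (criticalSetOfIndex (𝓡∂ (n + 1)) C.S.f 0).ncard = 1)
    (h2 : ∀ k, 2 ≤ k → (criticalSetOfIndex (𝓡∂ (n + 1)) C.S.f k).ncard = 0)
    (hmin : ∀ z ∈ criticalSetOfIndex (𝓡∂ (n + 1)) C.S.f 0, C.S.f z < C.c)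
    (v : C.toCtx.Sl'.Level (C.toCtx.c + C.toCtx.σ)) {x₀ : M}
    (A : Path x₀ (C.toCtx.Sl'.levelIncl v)) (hA : ∀ s, C.S.f (A s) ≤ C.c)
    (γ : Path x₀ x₀) (hγ : ∀ s, C.S.f (γ s) ≤ C.c) :
    ∃ β : Path v v,
      Path.Homotopic.Quotient.mk ((A.trans (β.map ((continuous_subtype_val.comp continuous_subtype_val) :
        Continuous (C.toCtx.Sl'.levelIncl : C.toCtx.Sl'.Level (C.toCtx.c + C.toCtx.σ) → M)))).trans A.symm) =
      Path.Homotopic.Quotient.mk γ := by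
  obtain ⟨β, hβ⟩ := C.exists_levelLoop_of_loop h0 h2 hmin v ((A.symm.trans γ).trans A) (fun s => by
    rw [Path.trans_apply]
    split_ifs
    · rw [Path.trans_apply]
      split_ifs
      · exact hA _
      · exact hγ _
    · exact hA _)
  refine ⟨β, ?_⟩
  rw [Path.Homotopic.Quotient.mk_trans, Path.Homotopic.Quotient.mk_trans, Path.Homotopic.Quotient.mk_symm]
  refine (congrArg (fun q => ((Path.Homotopic.Quotient.mk A).trans q).trans (Path.Homotopic.Quotient.mk A).symm) hβ).trans ?_
  simp only [Path.Homotopic.Quotient.mk_trans, Path.Homotopic.Quotient.mk_symm,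
    Path.Homotopic.Quotient.trans_assoc, IsotopyTrack.quotient_trans_symm_trans,
    Path.Homotopic.Quotient.trans_symm, Path.Homotopic.Quotient.trans_refl]

end SlideContext

end Literature.Topology.FourManifolds
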